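import Literature.Barriers.CriticalPhenomena.PlanarEdwardsModelDiffusiveSILTIntegral
import HarnessLib

/-!
# Mollified self-intersection local time of planar Brownian motion on time blocks
# (towards the exponential moments, Varadhan's renormalisation part (ii))

Sibling file of `Literature.Barriers.CriticalPhenomena.PlanarEdwardsModelDiffusive`. The proof of
`Edwards2D.Varadhan1969_negExpMoments` (the negative exponential moments `E e^{-λγ} < ∞`) runs by
binary splitting of the time square: `[0,1]² = [0,½]² ∪ [½,1]² ∪ 2·([0,½] × [½,1])`. This file
provides the block functionals

* `Edwards2D.rect a b c d` — Lebesgue measure on the time rectangle `[a,b] × [c,d]`;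
* `Edwards2D.blockSILT Z k a b c d = ∫_{[a,b]×[c,d]} g_k(Z_t - Z_s) ds dt` (the kernel process
  `Edwards2D.kernelProc` integrated over the block),

with their measurability and bounds, the first and second moments by Fubini
(`integral_blockSILT`, `integral_blockSILT_mul`), the covariance formula
`Cov(B_k(R), B_l(R')) = ∫_{R×R'} Φ_{k,l}` (`covariance_blockSILT`) and hence, since `Φ ≥ 0`
(`covDensity_nonneg`) and `∫_{[0,1]⁴} Φ ≤ 57` (`integral_covDensity_le`), the **uniform variance
bound `Var(B_k(R)) ≤ 57`** for blocks inside the unit square (`variance_blockSILT_le`); and the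
**uniform first-moment bound for the off-diagonal block**
`E B_k([0,½]×[½,1]) ≤ 1/π` (`integral_offDiagBlock_le`, from `(k/2π)/(1+k(t-s)) ≤ 1/(2π(t-s))` and
`(t - s)^{-1} ≤ (t-½)^{-1/2}(½-s)^{-1/2}`).

## References

* J.-F. Le Gall, Sém. Prob. XXVIII, LNM 1583 (1994), 172–180, (4)–(5) and facts (i)–(iii) (the
  dyadic block structure of the renormalised self-intersection local time).
* J.-F. Le Gall, Sém. Prob. XIX, LNM 1123 (1985), §1 (the squares `Aⁿ_k`).
-/

noncomputable section

open MeasureTheory ProbabilityTheory Real Filter Set Function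
open scoped NNReal ENNReal Topology

namespace Literature.Barriers.CriticalPhenomena

namespace Edwards2D

open Literature.Probability.Process

universe u

variable {Ω : Type u} {Z : ℝ≥0 → Ω → ℂ}

/-! ### Time rectangles -/

/-- Lebesgue measure on the time rectangle `[a,b] × [c,d]` (as a measure on `ℝ × ℝ`).
[cite: LeGall1985, §1 (the squares Aⁿ_k)] -/
def rect (a b c d : ℝ) : Measure (ℝ × ℝ) :=
  (volume.restrict (Icc a b)).prod (volume.restrict (Icc c d))

/-- `rect 0 1 0 1` is the unit square. [folklore] -/
theorem rect_unit : rect 0 1 0 1 = unitSq := rfl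

/-- A time rectangle has finite measure. [folklore] -/
instance isFiniteMeasure_rect (a b c d : ℝ) : IsFiniteMeasure (rect a b c d) := by
  unfold rect
  infer_instance

/-- The total mass of `[a,b] × [c,d]` is `(b-a)(d-c)` for `a ≤ b`, `c ≤ d`. [folklore] -/
theorem rect_real_univ {a b c d : ℝ} (hab : a ≤ b) (hcd : c ≤ d) :
    (rect a b c d).real univ = (b - a) * (d - c) := by
  rw [rect, ← univ_prod_univ, measureReal_def, Measure.prod_prod, Measure.restrict_apply_univ,
    Measure.restrict_apply_univ, Real.volume_Icc, Real.volume_Icc, ENNReal.toReal_mul,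
    ENNReal.toReal_ofReal (by linarith), ENNReal.toReal_ofReal (by linarith)]

/-- A rectangle inside the unit square is dominated by the unit-square measure. [folklore] -/
theorem rect_le_unitSq {a b c d : ℝ} (ha : 0 ≤ a) (hb : b ≤ 1) (hc : 0 ≤ c) (hd : d ≤ 1) :
    rect a b c d ≤ unitSq := by
  rw [rect, unitSq]
  exact Measure.prod_mono (Measure.restrict_mono (Icc_subset_Icc ha hb) le_rfl)
    (Measure.restrict_mono (Icc_subset_Icc hc hd) le_rfl)

/-! ### Block functionals -/

/-- The **block functional** `B_k([a,b]×[c,d]) = ∫_{[a,b]×[c,d]} g_k(Z_t - Z_s) ds dt` (the kernel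
process `Edwards2D.kernelProc` integrated over a time rectangle; `T_k = B_k([0,1]²)`,
`blockSILT_unit`). [cite: LeGall1994, (4)–(5)] -/
def blockSILT (Z : ℝ≥0 → Ω → ℂ) (k : ℕ) (a b c d : ℝ) (ω : Ω) : ℝ :=
  ∫ p, kernelProc Z k p ω ∂(rect a b c d)

/-- `T_k = B_k([0,1]²)`. [folklore] -/
theorem blockSILT_unit (hcont : ∀ ω, Continuous (Z · ω)) (k : ℕ) (ω : Ω) :
    blockSILT Z k 0 1 0 1 ω = mollifiedSILT Z k ω := by
  rw [blockSILT, rect_unit, mollifiedSILT_eq_integral_kernelProc hcont]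

/-- `H_k(·, ω)` is integrable on every time rectangle. [folklore] -/
theorem integrable_kernelProc_rect (hcont : ∀ ω, Continuous (Z · ω)) (k : ℕ) (a b c d : ℝ) (ω : Ω) :
    Integrable (fun p => kernelProc Z k p ω) (rect a b c d) :=
  Integrable.of_bound (continuous_kernelProc hcont k ω).aestronglyMeasurable _
    (ae_of_all _ fun p => norm_kernelProc_le Z k p ω)

/-- `B_k(R)` as an iterated integral. [folklore] -/
theorem blockSILT_eq_integral_integral (hcont : ∀ ω, Continuous (Z · ω)) (k : ℕ) (a b c d : ℝ)
    (ω : Ω) : blockSILT Z k a b c d ω = ∫ s in Icc a b, ∫ t in Icc c d, kernelProc Z k (s, t) ω := by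
  rw [blockSILT, rect, integral_prod _ (integrable_kernelProc_rect hcont k a b c d ω)]

/-- `0 ≤ B_k(R)`. [folklore] -/
theorem blockSILT_nonneg (k : ℕ) (a b c d : ℝ) (ω : Ω) : 0 ≤ blockSILT Z k a b c d ω :=
  integral_nonneg fun p => kernelProc_nonneg Z k p ω

/-- `B_k(R) ≤ (k/2π) |R|`. [folklore] -/
theorem blockSILT_le {a b c d : ℝ} (hab : a ≤ b) (hcd : c ≤ d) (k : ℕ) (ω : Ω) :
    blockSILT Z k a b c d ω ≤ k / (2 * π) * ((b - a) * (d - c)) := by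
  have h := norm_integral_le_of_norm_le_const (μ := rect a b c d) (C := (k : ℝ) / (2 * π))
    (f := fun p => kernelProc Z k p ω) (ae_of_all _ fun p => norm_kernelProc_le Z k p ω)
  rw [rect_real_univ hab hcd, Real.norm_eq_abs] at h
  exact (le_abs_self _).trans h

/-- `|B_k(R)| ≤ k/2π` for a rectangle inside the unit square. [folklore] -/
theorem norm_blockSILT_le {a b c d : ℝ} (ha : 0 ≤ a) (hab : a ≤ b) (hb : b ≤ 1) (hc : 0 ≤ c)
    (hcd : c ≤ d) (hd : d ≤ 1) (k : ℕ) (ω : Ω) : ‖blockSILT Z k a b c d ω‖ ≤ k / (2 * π) := by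
  rw [Real.norm_eq_abs, abs_of_nonneg (blockSILT_nonneg k a b c d ω)]
  refine (blockSILT_le hab hcd k ω).trans ?_
  have h1 : (b - a) * (d - c) ≤ 1 := by nlinarith
  have h0 : (0 : ℝ) ≤ k / (2 * π) := by positivity
  calc (k : ℝ) / (2 * π) * ((b - a) * (d - c)) ≤ k / (2 * π) * 1 := mul_le_mul_of_nonneg_left h1 h0
    _ = _ := mul_one _

section Measurable

variable [MeasurableSpace Ω] {P : Measure Ω}

/-- `B_k(R)` is measurable. [folklore] -/
theorem measurable_blockSILT (hmeas : ∀ t, Measurable (Z t)) (hcont : ∀ ω, Continuous (Z · ω))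
    (k : ℕ) (a b c d : ℝ) : Measurable (blockSILT Z k a b c d) :=
  ((measurable_uncurry_kernelProc hmeas hcont k).stronglyMeasurable.integral_prod_left
    (μ := rect a b c d)).measurable

/-- `B_k(R)` is in every `Lᵖ` for a rectangle inside the unit square. [folklore] -/
theorem memLp_blockSILT [IsFiniteMeasure P] (hmeas : ∀ t, Measurable (Z t))
    (hcont : ∀ ω, Continuous (Z · ω)) (k : ℕ) {a b c d : ℝ} (ha : 0 ≤ a) (hab : a ≤ b) (hb : b ≤ 1)
    (hc : 0 ≤ c) (hcd : c ≤ d) (hd : d ≤ 1) (q : ℝ≥0∞) : MemLp (blockSILT Z k a b c d) q P :=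
  MemLp.of_bound (measurable_blockSILT hmeas hcont k a b c d).aestronglyMeasurable _
    (ae_of_all _ fun ω => norm_blockSILT_le ha hab hb hc hcd hd k ω)

/-- `B_k(R)` is integrable. [folklore] -/
theorem integrable_blockSILT [IsFiniteMeasure P] (hmeas : ∀ t, Measurable (Z t))
    (hcont : ∀ ω, Continuous (Z · ω)) (k : ℕ) {a b c d : ℝ} (ha : 0 ≤ a) (hab : a ≤ b) (hb : b ≤ 1)
    (hc : 0 ≤ c) (hcd : c ≤ d) (hd : d ≤ 1) : Integrable (blockSILT Z k a b c d) P :=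
  Integrable.of_bound (measurable_blockSILT hmeas hcont k a b c d).aestronglyMeasurable _
    (ae_of_all _ fun ω => norm_blockSILT_le ha hab hb hc hcd hd k ω)

/-! ### Moments of the block functionals -/

/-- Joint integrability of the kernel process on `R × Ω`. [folklore] -/
theorem integrable_uncurry_kernelProc_rect [IsProbabilityMeasure P] (hmeas : ∀ t, Measurable (Z t))
    (hcont : ∀ ω, Continuous (Z · ω)) (k : ℕ) (a b c d : ℝ) :
    Integrable (uncurry (kernelProc Z k)) ((rect a b c d).prod P) :=
  Integrable.of_bound (measurable_uncurry_kernelProc hmeas hcont k).aestronglyMeasurable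
    (k / (2 * π)) (ae_of_all _ fun x => norm_kernelProc_le Z k x.1 x.2)

/-- **`E B_k(R) = ∫_R (k/2π)/(1 + k|t-s|) ds dt`**. [cite: LeGall1985, §2, (2-a)] -/
theorem integral_blockSILT [IsProbabilityMeasure P] (hZ : IsBrownianComplex Z P)
    (hmeas : ∀ t, Measurable (Z t)) (hcont : ∀ ω, Continuous (Z · ω)) (k : ℕ) (a b c d : ℝ) :
    ∫ ω, blockSILT Z k a b c d ω ∂P =
      ∫ p : ℝ × ℝ, (k : ℝ) / (2 * π) / (1 + k * |((p.2.toNNReal : ℝ≥0) : ℝ) - p.1.toNNReal|)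
        ∂(rect a b c d) := by
  simp only [blockSILT]
  rw [← integral_integral_swap (integrable_uncurry_kernelProc_rect hmeas hcont k a b c d)]
  exact integral_congr_ae (ae_of_all _ fun p => integral_kernelProc hZ hmeas k p)

/-- Joint integrability of the product of two kernel processes on `(R × R') × Ω`. [folklore] -/
theorem integrable_uncurry_kernelProc_mul_rect [IsProbabilityMeasure P] (hmeas : ∀ t, Measurable (Z t))
    (hcont : ∀ ω, Continuous (Z · ω)) (k l : ℕ) (a b c d a' b' c' d' : ℝ) :
    Integrable (uncurry fun (pq : (ℝ × ℝ) × (ℝ × ℝ)) ω => kernelProc Z k pq.1 ω * kernelProc Z l pq.2 ω)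
      (((rect a b c d).prod (rect a' b' c' d')).prod P) := by
  have hm : Measurable (uncurry fun (pq : (ℝ × ℝ) × (ℝ × ℝ)) ω =>
      kernelProc Z k pq.1 ω * kernelProc Z l pq.2 ω) := by
    have hπ1 : Measurable fun x : ((ℝ × ℝ) × (ℝ × ℝ)) × Ω => ((x.1.1, x.2) : (ℝ × ℝ) × Ω) :=
      (measurable_fst.comp measurable_fst).prodMk measurable_snd
    have hπ2 : Measurable fun x : ((ℝ × ℝ) × (ℝ × ℝ)) × Ω => ((x.1.2, x.2) : (ℝ × ℝ) × Ω) :=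
      (measurable_snd.comp measurable_fst).prodMk measurable_snd
    have h1 := (measurable_uncurry_kernelProc hmeas hcont k).comp hπ1
    have h2 := (measurable_uncurry_kernelProc hmeas hcont l).comp hπ2
    exact h1.mul h2
  refine Integrable.of_bound hm.aestronglyMeasurable (k / (2 * π) * (l / (2 * π)))
    (ae_of_all _ fun x => ?_)
  simp only [uncurry]
  rw [norm_mul]
  exact mul_le_mul (norm_kernelProc_le Z k _ _) (norm_kernelProc_le Z l _ _) (norm_nonneg _)
    (by positivity)

/-- **`E[B_k(R) B_l(R')] = ∫_{R×R'} (kl/(2π)²)/D`**. [folklore] -/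
theorem integral_blockSILT_mul [IsProbabilityMeasure P] (hZ : IsBrownianComplex Z P)
    (hmeas : ∀ t, Measurable (Z t)) (hcont : ∀ ω, Continuous (Z · ω)) (k l : ℕ)
    (a b c d a' b' c' d' : ℝ) :
    ∫ ω, blockSILT Z k a b c d ω * blockSILT Z l a' b' c' d' ω ∂P =
      ∫ pq : (ℝ × ℝ) × (ℝ × ℝ), (k : ℝ) / (2 * π) * (l / (2 * π)) /
        ((1 + k * |((pq.1.2.toNNReal : ℝ≥0) : ℝ) - pq.1.1.toNNReal|) *
            (1 + l * |((pq.2.2.toNNReal : ℝ≥0) : ℝ) - pq.2.1.toNNReal|) -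
          k * l * incrCov pq.1.1.toNNReal pq.1.2.toNNReal pq.2.1.toNNReal pq.2.2.toNNReal ^ 2)
        ∂((rect a b c d).prod (rect a' b' c' d')) := by
  simp only [blockSILT]
  have hprod : ∀ ω, (∫ p, kernelProc Z k p ω ∂rect a b c d) * (∫ q, kernelProc Z l q ω ∂rect a' b' c' d') =
      ∫ pq : (ℝ × ℝ) × (ℝ × ℝ), kernelProc Z k pq.1 ω * kernelProc Z l pq.2 ω
        ∂((rect a b c d).prod (rect a' b' c' d')) :=
    fun ω => (integral_prod_mul (μ := rect a b c d) (ν := rect a' b' c' d')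
      (fun p => kernelProc Z k p ω) (fun q => kernelProc Z l q ω)).symm
  simp_rw [hprod]
  rw [← integral_integral_swap (integrable_uncurry_kernelProc_mul_rect hmeas hcont k l _ _ _ _ _ _ _ _)]
  exact integral_congr_ae (ae_of_all _ fun pq => integral_kernelProc_mul hZ hmeas k l pq.1 pq.2)

/-- The first-moment density is integrable on every rectangle. [folklore] -/
theorem integrable_meanDensity_rect (k : ℕ) (a b c d : ℝ) :
    Integrable (fun p : ℝ × ℝ => (k : ℝ) / (2 * π) / (1 + k * |((p.2.toNNReal : ℝ≥0) : ℝ) - p.1.toNNReal|))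
      (rect a b c d) :=
  Integrable.of_bound (continuous_meanDensity k).aestronglyMeasurable _
    (ae_of_all _ fun p => norm_meanDensity_le k p)

/-- **`Cov(B_k(R), B_l(R')) = ∫_{R×R'} Φ_{k,l}`**. [folklore] -/
theorem covariance_blockSILT [IsProbabilityMeasure P] (hZ : IsBrownianComplex Z P)
    (hmeas : ∀ t, Measurable (Z t)) (hcont : ∀ ω, Continuous (Z · ω)) (k l : ℕ)
    {a b c d a' b' c' d' : ℝ} (ha : 0 ≤ a) (hab : a ≤ b) (hb : b ≤ 1) (hc : 0 ≤ c) (hcd : c ≤ d)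
    (hd : d ≤ 1) (ha' : 0 ≤ a') (hab' : a' ≤ b') (hb' : b' ≤ 1) (hc' : 0 ≤ c') (hcd' : c' ≤ d')
    (hd' : d' ≤ 1) :
    cov[blockSILT Z k a b c d, blockSILT Z l a' b' c' d'; P] =
      ∫ pq, covDensity k l pq ∂((rect a b c d).prod (rect a' b' c' d')) := by
  rw [covariance_eq_sub (memLp_blockSILT hmeas hcont k ha hab hb hc hcd hd 2)
    (memLp_blockSILT hmeas hcont l ha' hab' hb' hc' hcd' hd' 2)]
  rw [show (blockSILT Z k a b c d * blockSILT Z l a' b' c' d') =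
      fun ω => blockSILT Z k a b c d ω * blockSILT Z l a' b' c' d' ω from rfl,
    integral_blockSILT_mul hZ hmeas hcont, integral_blockSILT hZ hmeas hcont,
    integral_blockSILT hZ hmeas hcont]
  rw [← integral_prod_mul (μ := rect a b c d) (ν := rect a' b' c' d')
    (fun p : ℝ × ℝ => (k : ℝ) / (2 * π) / (1 + k * |((p.2.toNNReal : ℝ≥0) : ℝ) - p.1.toNNReal|))
    (fun q : ℝ × ℝ => (l : ℝ) / (2 * π) / (1 + l * |((q.2.toNNReal : ℝ≥0) : ℝ) - q.1.toNNReal|))]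
  rw [← integral_sub]
  · refine integral_congr_ae (ae_of_all _ fun pq => ?_)
    have hD := discr_pos hZ hmeas k l pq.1 pq.2
    simp only [covDensity]
    field_simp
  · exact Integrable.of_bound (measurable_secondDensity k l).aestronglyMeasurable _
      (ae_of_all _ fun pq => norm_secondDensity_le hZ hmeas k l pq)
  · refine Integrable.of_bound ?_ (k / (2 * π) * (l / (2 * π))) (ae_of_all _ fun pq => ?_)
    · exact (((continuous_meanDensity k).comp continuous_fst).mul
        ((continuous_meanDensity l).comp continuous_snd)).aestronglyMeasurable
    · rw [norm_mul]
      exact mul_le_mul (norm_meanDensity_le k pq.1) (norm_meanDensity_le l pq.2) (norm_nonneg _)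
        (by positivity)

/-- **Uniform variance bound for blocks**: `Var(B_k(R)) ≤ 57` for every rectangle `R` inside the
unit square and every `k` (`Φ ≥ 0` and `∫_{[0,1]⁴} Φ ≤ 57`). [folklore] -/
theorem variance_blockSILT_le [IsProbabilityMeasure P] (hZ : IsBrownianComplex Z P)
    (hmeas : ∀ t, Measurable (Z t)) (hcont : ∀ ω, Continuous (Z · ω)) (k : ℕ) {a b c d : ℝ}
    (ha : 0 ≤ a) (hab : a ≤ b) (hb : b ≤ 1) (hc : 0 ≤ c) (hcd : c ≤ d) (hd : d ≤ 1) :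
    Var[blockSILT Z k a b c d; P] ≤ 57 := by
  rw [← covariance_self (measurable_blockSILT hmeas hcont k a b c d).aemeasurable,
    covariance_blockSILT hZ hmeas hcont k k ha hab hb hc hcd hd ha hab hb hc hcd hd]
  calc ∫ pq, covDensity k k pq ∂((rect a b c d).prod (rect a b c d))
      ≤ ∫ pq, covDensity k k pq ∂(unitSq.prod unitSq) := by
        refine integral_mono_measure ?_ (ae_of_all _ fun pq => covDensity_nonneg k k pq)
          (integrable_covDensity k k)
        exact Measure.prod_mono (rect_le_unitSq ha hb hc hd) (rect_le_unitSq ha hb hc hd)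
    _ ≤ 57 := integral_covDensity_le k k

/-! ### The off-diagonal block `[0,½] × [½,1]`: a uniform first-moment bound -/

/-- `(k/2π)/(1 + k x) ≤ 1/(2π x)` for `x > 0`. [folklore] -/
theorem meanDensity_le_inv {k : ℕ} {x : ℝ} (hx : 0 < x) : (k : ℝ) / (2 * π) / (1 + k * x) ≤ 1 / (2 * π * x) := by
  rw [div_div, div_le_div_iff₀ (by positivity) (by positivity), one_mul]
  nlinarith [Real.pi_pos, mul_pos Real.pi_pos hx]

/-- `∫_{[0,½]} (½ - s)^{-1/2} ds ≤ 2` and `∫_{[½,1]} (t - ½)^{-1/2} dt ≤ 2` (both equal `√2`).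
[folklore] -/
theorem integral_rpow_half_le :
    ∫ s in Icc (0 : ℝ) (1 / 2), (1 / 2 - s) ^ (-(1 / 2) : ℝ) ≤ 2 ∧
    ∫ t in Icc (1 / 2 : ℝ) 1, (t - 1 / 2) ^ (-(1 / 2) : ℝ) ≤ 2 := by
  have hr : (-1 : ℝ) < -(1 / 2) := by norm_num
  have hval : ∫ x in (0 : ℝ)..(1 / 2), x ^ (-(1 / 2) : ℝ) = √2 := by
    rw [integral_rpow (Or.inl hr)]
    have h1 : (1 / 2 : ℝ) ^ (-(1 / 2) + 1 : ℝ) = √2 / 2 := by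
      rw [show (-(1 / 2) + 1 : ℝ) = 1 / 2 by norm_num, ← Real.sqrt_eq_rpow, Real.sqrt_div' _ zero_le_two,
        Real.sqrt_one, Real.sqrt_eq_rpow]
      field_simp
      rw [← Real.sqrt_eq_rpow, Real.sq_sqrt zero_le_two]
    rw [h1, Real.zero_rpow (by norm_num)]
    ring
  have hsqrt2 : √2 ≤ 2 := by
    nlinarith [Real.sq_sqrt (show (0 : ℝ) ≤ 2 by norm_num), Real.sqrt_nonneg 2]
  constructor
  · rw [integral_Icc_eq_integral_Ioc, ← intervalIntegral.integral_of_le (by norm_num : (0 : ℝ) ≤ 1 / 2),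
      intervalIntegral.integral_comp_sub_left (fun x : ℝ => x ^ (-(1 / 2) : ℝ)) (1 / 2)]
    norm_num
    rw [hval]
    exact hsqrt2
  · rw [integral_Icc_eq_integral_Ioc, ← intervalIntegral.integral_of_le (by norm_num : (1 / 2 : ℝ) ≤ 1),
      intervalIntegral.integral_comp_sub_right (fun x : ℝ => x ^ (-(1 / 2) : ℝ)) (1 / 2)]
    norm_num
    rw [hval]
    exact hsqrt2

/-- The AM–GM pointwise bound on the off-diagonal block: for `s < ½ < t`,
`(k/2π)/(1 + k(t-s)) ≤ (1/4π) (½-s)^{-1/2} (t-½)^{-1/2}`. [folklore] -/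
theorem meanDensity_offDiag_le (k : ℕ) {s t : ℝ} (hs0 : 0 ≤ s) (hs : s < 1 / 2) (ht : 1 / 2 < t) :
    (k : ℝ) / (2 * π) / (1 + k * |((t.toNNReal : ℝ≥0) : ℝ) - s.toNNReal|) ≤
      1 / (4 * π) * ((1 / 2 - s) ^ (-(1 / 2) : ℝ) * (t - 1 / 2) ^ (-(1 / 2) : ℝ)) := by
  have h1 : 0 < 1 / 2 - s := by linarith
  have h2 : 0 < t - 1 / 2 := by linarith
  rw [Real.coe_toNNReal _ hs0, Real.coe_toNNReal _ (by linarith), abs_of_pos (by linarith)]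
  refine (meanDensity_le_inv (by linarith)).trans ?_
  rw [← Real.mul_rpow h1.le h2.le, Real.rpow_neg (by positivity), ← Real.sqrt_eq_rpow]
  have hsqpos : 0 < √((1 / 2 - s) * (t - 1 / 2)) := Real.sqrt_pos.2 (by positivity)
  have hAM : 2 * √((1 / 2 - s) * (t - 1 / 2)) ≤ t - s := by
    nlinarith [sq_nonneg (√(1 / 2 - s) - √(t - 1 / 2)), Real.mul_self_sqrt h1.le,
      Real.mul_self_sqrt h2.le, Real.sqrt_mul h1.le (t - 1 / 2)]
  rw [show 1 / (4 * π) * (√((1 / 2 - s) * (t - 1 / 2)))⁻¹ = 1 / (2 * π * (2 * √((1 / 2 - s) * (t - 1 / 2))))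
    by field_simp; ring]
  exact one_div_le_one_div_of_le (by positivity) (by nlinarith [Real.pi_pos])

/-- `t ↦ (t - ½)^{-1/2}` is integrable on `[½, 1]` and `s ↦ (½ - s)^{-1/2}` on `[0, ½]` (improper
but convergent). [folklore] -/
theorem integrableOn_rpow_neg_half :
    IntegrableOn (fun t : ℝ => (t - 1 / 2) ^ (-(1 / 2) : ℝ)) (Icc (1 / 2 : ℝ) 1) ∧
    IntegrableOn (fun s : ℝ => (1 / 2 - s) ^ (-(1 / 2) : ℝ)) (Icc (0 : ℝ) (1 / 2)) := by
  have hr : (-1 : ℝ) < -(1 / 2) := by norm_num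
  have h0 := intervalIntegral.intervalIntegrable_rpow' hr (a := 0) (b := 1 / 2)
  constructor
  · have h := h0.comp_sub_right (1 / 2)
    norm_num at h
    exact (intervalIntegrable_iff_integrableOn_Icc_of_le (by norm_num)).1 h
  · have h := (h0.comp_sub_left (1 / 2)).symm
    norm_num at h
    exact (intervalIntegrable_iff_integrableOn_Icc_of_le (by norm_num)).1 h

/-- Lebesgue-almost every real number differs from `½`. [folklore] -/
theorem ae_ne_half (S : Set ℝ) : ∀ᵐ x : ℝ ∂(volume.restrict S), x ≠ 1 / 2 := by
  refine ae_restrict_of_ae ?_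
  rw [ae_iff]
  simp

/-- **Uniform first-moment bound for the off-diagonal block**: `E B_k([0,½]×[½,1]) ≤ 1/π` for all
`k` (`(k/2π)/(1+k(t-s)) ≤ 1/(2π(t-s))`, `t - s ≥ 2√((t-½)(½-s))`, and the two half-integrals
`∫ (t-½)^{-1/2}, ∫ (½-s)^{-1/2} ≤ 2`). [cite: LeGall1994, facts (i)–(iii) after (5)] -/
theorem integral_offDiagBlock_le [IsProbabilityMeasure P] (hZ : IsBrownianComplex Z P)
    (hmeas : ∀ t, Measurable (Z t)) (hcont : ∀ ω, Continuous (Z · ω)) (k : ℕ) :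
    ∫ ω, blockSILT Z k 0 (1 / 2) (1 / 2) 1 ω ∂P ≤ 1 / π := by
  have hFint := integrable_meanDensity_rect k 0 (1 / 2) (1 / 2) 1
  rw [integral_blockSILT hZ hmeas hcont]
  rw [rect] at hFint ⊢
  rw [integral_prod _ hFint]
  set f : ℝ × ℝ → ℝ := fun p => (k : ℝ) / (2 * π) / (1 + k * |((p.2.toNNReal : ℝ≥0) : ℝ) - p.1.toNNReal|)
    with hf
  set G : ℝ → ℝ := fun s => (1 / 2 - s) ^ (-(1 / 2) : ℝ) with hG
  set G' : ℝ → ℝ := fun t => (t - 1 / 2) ^ (-(1 / 2) : ℝ) with hG'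
  have hGI : ∫ s in Icc (0 : ℝ) (1 / 2), G s ≤ 2 := integral_rpow_half_le.1
  have hG'I : ∫ t in Icc (1 / 2 : ℝ) 1, G' t ≤ 2 := integral_rpow_half_le.2
  have hG'int : IntegrableOn G' (Icc (1 / 2 : ℝ) 1) := integrableOn_rpow_neg_half.1
  have hGint : IntegrableOn G (Icc (0 : ℝ) (1 / 2)) := integrableOn_rpow_neg_half.2
  -- inner bound, for `s ∈ [0, ½)`
  have hinner : ∀ s ∈ Ico (0 : ℝ) (1 / 2), ∫ t in Icc (1 / 2 : ℝ) 1, f (s, t) ≤ 1 / (4 * π) * G s * 2 := by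
    intro s hs
    have hGs : 0 ≤ G s := Real.rpow_nonneg (by linarith [hs.2]) _
    have hfs : Integrable (fun t => f (s, t)) (volume.restrict (Icc (1 / 2 : ℝ) 1)) :=
      Integrable.of_bound ((continuous_meanDensity k).comp
        (continuous_const.prodMk continuous_id)).aestronglyMeasurable _
        (ae_of_all _ fun t => norm_meanDensity_le k (s, t))
    calc ∫ t in Icc (1 / 2 : ℝ) 1, f (s, t)
        ≤ ∫ t in Icc (1 / 2 : ℝ) 1, 1 / (4 * π) * G s * G' t := by
          refine integral_mono_ae hfs (hG'int.const_mul _) ?_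
          filter_upwards [ae_restrict_mem measurableSet_Icc, ae_ne_half (Icc (1 / 2 : ℝ) 1)] with t ht hne
          have ht' : 1 / 2 < t := lt_of_le_of_ne ht.1 (Ne.symm hne)
          have h := meanDensity_offDiag_le k hs.1 hs.2 ht'
          rw [hf, hG, hG']
          simpa [mul_assoc] using h
      _ = 1 / (4 * π) * G s * ∫ t in Icc (1 / 2 : ℝ) 1, G' t := integral_const_mul _ _
      _ ≤ 1 / (4 * π) * G s * 2 := mul_le_mul_of_nonneg_left hG'I (mul_nonneg (by positivity) hGs)
  -- outer bound
  have hIint : Integrable (fun s => ∫ t in Icc (1 / 2 : ℝ) 1, f (s, t))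
      (volume.restrict (Icc (0 : ℝ) (1 / 2))) := hFint.integral_prod_left
  calc ∫ s in Icc (0 : ℝ) (1 / 2), ∫ t in Icc (1 / 2 : ℝ) 1, f (s, t)
      ≤ ∫ s in Icc (0 : ℝ) (1 / 2), 1 / (4 * π) * G s * 2 := by
        refine integral_mono_ae hIint ((hGint.const_mul (1 / (4 * π))).mul_const 2) ?_
        filter_upwards [ae_restrict_mem measurableSet_Icc, ae_ne_half (Icc (0 : ℝ) (1 / 2))] with s hs hne
        exact hinner s ⟨hs.1, lt_of_le_of_ne hs.2 hne⟩
    _ = ∫ s in Icc (0 : ℝ) (1 / 2), (1 / (4 * π) * 2) * G s := by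
        congr 1
        funext s
        ring
    _ = 1 / (4 * π) * 2 * ∫ s in Icc (0 : ℝ) (1 / 2), G s := integral_const_mul _ _
    _ ≤ 1 / (4 * π) * 2 * 2 := mul_le_mul_of_nonneg_left hGI (by positivity)
    _ = 1 / π := by ring

end Measurable

end Edwards2D

end Literature.Barriers.CriticalPhenomena
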